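import Mathlib.RingTheory.RamificationInertia.Inertia
import Mathlib.RingTheory.Ideal.Over
import Mathlib.FieldTheory.Galois.Basic
import Mathlib.NumberTheory.NumberField.AdeleRing
import Literature.NumberTheory.Automorphic.AutomorphicRepsGL
import HarnessLib

-- provenance: harness21/H21/H21/Statements/Lang/BaseChangeGLn.lean @ ddef690 (interim HEAD d8f2665); M5 mechanical rewrite
/-!
# Cyclic base change of prime degree for `GL_n` (Arthur–Clozel): existence half

Trunk: AutomorphicL; family Lang (statement file, item `LangBaseChangeGLn`; notions
`automorphic_form`, `automorphic_representation`, `satake_isomorphism`; OUTLINE §3, review 16).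

Let `E / K` be a cyclic extension of number fields of prime degree `ℓ` and `π` a cuspidal
automorphic representation of `GL_n(𝔸_K)`. Arthur–Clozel (Ann. of Math. Studies 120 (1989),
Thm. III.4.2 (a)) prove that the *base-change lift* `Π = BC_{E/K}(π)` exists: an automorphic
representation of `GL_n(𝔸_E)` (an irreducible subquotient of the space of automorphic forms —
it is cuspidal, or isobaric, induced from cuspidal, when `π ≅ π ⊗ η` for a character `η` cutting
out `E`) such that at every finite place `w` of `E` above a place `v` of `K` at which `π` and
`E / K` are unramified, `Π_w` is unramified with Satake class `c(Π_w) = c(π_v)^{f_w}`, where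
`f_w = f(w | v)` is the residue degree (so `f_w = 1` at split places and `f_w = ℓ` at inert ones).

* **lang.S23** `Literature.NumberTheory.Automorphic.exists_baseChange_cyclic` (named fact, D-0014): the existence half,
  with the Satake relation
  stated at all but finitely many finite places `w` of `E` in the adelic language of the accepted
  `AutomorphicRepData.HasSatakeParamAt` (`AutomorphicRepsGL`): if `π` has Satake parameter `α`
  (a multiset of `n` complex numbers) at `v = w ∩ 𝓞 K`, then `Π` has Satake parameter
  `α ^ f_w = α.map (· ^ f_w)` at `w`.
* `Literature.NumberTheory.Automorphic.exists_baseChange_cyclic_split` (untagged corollary): at split places (`f_w = 1`) the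
  Satake parameter of the lift is that of `π`.

## What is NOT covered

Arthur–Clozel III.4.2 (b) and III.5.1 — `Π` is a base-change lift iff `Π ≅ Π^σ` for a generator
`σ` of `Gal(E/K)`, and the fibres of `BC_{E/K}` on cuspidal representations are the twists
`π ⊗ ηⁱ` by the characters `η` of `𝔸_Kˣ / Kˣ N_{E/K}(𝔸_Eˣ)` — require the action of `Gal(E/K)` on
functions on `GL_n(𝔸_E)`, i.e. functoriality of Mathlib's `NumberField.AdeleRing (𝓞 E) E` in
field automorphisms of `E` (transport of `HeightOneSpectrum (𝓞 E)`, of the finite adeles and of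
`mixedSpace E` along `σ`), which is absent from the Mathlib pin. Only the existence half (a) is
stated. Likewise the remark "`Π` is cuspidal unless `π ≅ π ⊗ η`" is omitted (it needs the
idèle class characters of `E / K` as automorphic representations of `GL_1`).

## Design notes

* Place data are Mathlib's: `Algebra (𝓞 K) (𝓞 E)` (`NumberTheory/NumberField/Basic.lean`),
  the prime below `w.asIdeal.under (𝓞 K)` (`Ideal.under`, `RingTheory/Ideal/Over.lean`) and the
  residue degree `w.asIdeal.inertiaDeg (𝓞 K)` of `w` over it (`Ideal.inertiaDeg`,
  `RingTheory/RamificationInertia/Basic.lean`); cyclicity is `IsCyclic (E ≃ₐ[K] E)` with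
  `IsGalois K E`, and the degree is `Module.finrank K E`.
* The hypothesis `w.asIdeal.under (𝓞 K) = v.asIdeal` is stated for an arbitrary
  `v : HeightOneSpectrum (𝓞 K)` rather than by constructing `v` from `w` (the prime below a
  non-zero prime of `𝓞 E` is a non-zero prime of `𝓞 K` since `𝓞 E / 𝓞 K` is integral, but
  packaging this as a `HeightOneSpectrum` map is not needed for the statement).
* "All but finitely many `w`" (`Filter.cofinite` on `HeightOneSpectrum (𝓞 E)`) absorbs both the
  finitely many places where `E / K` ramifies and the finitely many where `π` ramifies; at the
  remaining `w` the hypothesis `π.1.HasSatakeParamAt v α` is non-vacuous by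
  `AutomorphicRepData.hasSatakeParamAt_cofinite`, and the conclusion pins down the Satake
  parameter of `Π` at `w` by `AutomorphicRepData.hasSatakeParamAt_unique`.
* (H1) `attribute [local instance 100] LieRing.ofAssociativeRing`; (H5) `open scoped Classical`.
* Mathlib (grepped) has no adelic automorphic representations, base change or Satake
  parameters; `Ideal.under`, `Ideal.inertiaDeg`, `IsCyclic`, `IsGalois`, `Module.finrank`,
  `IsDedekindDomain.HeightOneSpectrum`, `Filter.cofinite` are used as is.

## References

* J. Arthur, L. Clozel, *Simple algebras, base change, and the advanced theory of the trace
  formula*, Ann. of Math. Studies 120 (1989), Ch. 3, Thm. 4.2 and Thm. 5.1.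
* R. P. Langlands, *Base change for GL(2)*, Ann. of Math. Studies 96 (1980).
-/

-- Mathlib idiom (Mathlib/Algebra/Lie/OfAssociative.lean); needed to mention Lie subalgebras of matrix algebras
attribute [local instance 100] LieRing.ofAssociativeRing

open scoped Classical
open NumberField IsDedekindDomain Literature.NumberTheory.Automorphic

noncomputable section

namespace Literature.NumberTheory.Automorphic

/-- **lang.S23** (cyclic base change of prime degree for `GL_n`, existence half; Arthur–Clozel,
Ann. of Math. Studies 120 (1989), Thm. III.4.2 (a)). Let `E / K` be a cyclic Galois extension of
number fields of prime degree and `π` a cuspidal automorphic representation of `GL_n(𝔸_K)`. Then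
there is an automorphic representation `Π = BC_{E/K}(π)` of `GL_n(𝔸_E)` (an irreducible
subquotient `W / W'` of the space of automorphic forms for `AutomorphyDatum.gl n E`) such that,
for all but finitely many finite places `w` of `E`, if `v` is the place of `K` below `w`
(`w.asIdeal ∩ 𝓞 K = v.asIdeal`) and `π` has Satake parameter `α` at `v`, then `Π` has Satake
parameter `α ^ {f_w} = α.map (· ^ f_w)` at `w`, `f_w = f(w | v)` the residue degree; i.e.
`c(Π_w) = c(π_v)^{f_w}`.

NOT covered (see the module docstring): the characterisation of the image (`Π ≅ Π^σ`,
III.4.2 (b)) and of the fibres (twists by characters of `𝔸_Kˣ / Kˣ N(𝔸_Eˣ)`, III.5.1), which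
need the `Gal(E/K)`-action on functions on `GL_n(𝔸_E)` (functoriality of `AdeleRing` in field
automorphisms, absent from Mathlib).

Named fact (D-0014), not proved here; fully quantified inside (over `n`, `K`, `E` and the named
facts `hK`, `hE : isCompact_glFiniteIntegralLevel n _` on which the automorphy data
`AutomorphyDatum.gl n _ _` depend, cf. the M5 note of `AutomorphicRepsGL`), so that one witness
`(hBC : exists_baseChange_cyclic)` serves every instance. [cite: ArthurClozel1989, Thm. III.4.2 (a)] -/
def exists_baseChange_cyclic : Prop :=
  ∀ (n : ℕ) (K E : Type) [Field K] [NumberField K] [Field E] [NumberField E] [Algebra K E]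
    [IsGalois K E] (hK : isCompact_glFiniteIntegralLevel n K)
    (hE : isCompact_glFiniteIntegralLevel n E), IsCyclic (E ≃ₐ[K] E) →
      (Module.finrank K E).Prime → ∀ π : CuspidalAutomorphicRepData n K hK,
        ∃ BC : AutomorphicRepData (AutomorphyDatum.gl n E hE),
          ∀ᶠ w : HeightOneSpectrum (𝓞 E) in Filter.cofinite,
            ∀ (v : HeightOneSpectrum (𝓞 K)) (α : Multiset ℂ),
              w.asIdeal.under (𝓞 K) = v.asIdeal → π.1.HasSatakeParamAt v α →
                BC.HasSatakeParamAt w (α.map (· ^ w.asIdeal.inertiaDeg (𝓞 K)))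

/-- Cyclic base change at **split places** (corollary of Arthur–Clozel 1989, Thm. III.4.2 (a)):
with `E / K`, `π` as in `exists_baseChange_cyclic`, there is an automorphic representation
`Π` of `GL_n(𝔸_E)` such that for all but finitely many finite places `w` of `E` that are split
over the place `v` of `K` below (`f(w | v) = 1`), a Satake parameter `α` of `π` at `v` is a Satake
parameter of `Π` at `w`: `c(Π_w) = c(π_v)`, i.e. `Π_w ≅ π_v` under `E_w = K_v`. Proved from the
named fact `hBC : exists_baseChange_cyclic`. [cite: ArthurClozel1989, Thm. III.4.2 (a)] -/
theorem exists_baseChange_cyclic_split (hBC : exists_baseChange_cyclic) (n : ℕ) (K E : Type)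
    [Field K] [NumberField K] [Field E] [NumberField E] [Algebra K E] [IsGalois K E]
    (hK : isCompact_glFiniteIntegralLevel n K) (hE : isCompact_glFiniteIntegralLevel n E)
    (hcyc : IsCyclic (E ≃ₐ[K] E)) (hp : (Module.finrank K E).Prime)
    (π : CuspidalAutomorphicRepData n K hK) :
    ∃ BC : AutomorphicRepData (AutomorphyDatum.gl n E hE),
      ∀ᶠ w : HeightOneSpectrum (𝓞 E) in Filter.cofinite,
        ∀ (v : HeightOneSpectrum (𝓞 K)) (α : Multiset ℂ), w.asIdeal.under (𝓞 K) = v.asIdeal →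
          w.asIdeal.inertiaDeg (𝓞 K) = 1 → π.1.HasSatakeParamAt v α →
            BC.HasSatakeParamAt w α := by
  obtain ⟨BC, hw⟩ := hBC n K E hK hE hcyc hp π
  refine ⟨BC, hw.mono fun w hw v α hv hf hα ↦ ?_⟩
  have h := hw v α hv hα
  rw [hf] at h
  simpa using h

end Literature.NumberTheory.Automorphic

end
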